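import Summits.CriticalPhenomena.PercolationContinuityZ3.Theorems.PercNearOneGluingNoHeavyQuantGatedShiftPartial
import HarnessLib

/-!
# QUANT lane R8, T-DEC, leg (III): FULL `SingleGateConvClosed` programme — H/V EXCLUSIVITY and the giant arcs of a LOW copy

builds on p205010 (kernel theorem, internal audit signed; external expert review pending)

Support file (`--supports stmt-CriticalPhenomena-4575`), QUANT lane seat prim-quant-arm-2 (gen 37), rung R8 of
`run/shared/lean/prim/quant/LADDER.md`.  Theorems only, standard axioms, no sorries.  Memo `…/prim-quant-arm-2-g37/L2-TRANSPORT-G37.md` §8–§10.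
THE TWO-FAMILY CONSTRUCTION (general admissible `μ₁ ⊗ μ₂`, product layer `j`, target `τ′ = τ₁ + τ₂`): family H ships the product lows
`(a′, s)` (`a′` a `μ₁`-low, `s` a `μ₂`-atom with `2s ≥ τ₂`) along `μ₁`'s flow at layer `j − s`; family V ships `(a, s″)` (`2a ≥ τ₁`, `s″` a
`μ₂`-low) along `μ₂`'s flow at layer `j − a`.  This file holds the two arithmetic facts that keep the families apart and the certificate a LOW
copy (shift `s` with `2s < Δ`) still provides through its GIANT arcs (rates of giant arcs do not depend on the shift).

* `LawDec.hv_exclusive` — a product pair `(h, s)` cannot take a mid load from both families: an H-arc into it forces `2s − τ₂ < 2h − τ₁`, a V-arc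
  the reverse (SOURCE compatibility of both arcs is what is used).
* `LawDec.slot_exclusive` — a slot pair `(m, s)` of a fully present H-copy (`2s < τ′`, `τ₁ < m`) takes no V-arc.
* `LawDec.lowCopy_giants` — for any shift `s ≥ 1` and weight `c ≥ 0`: the giant-bound masses `R` of the copy's nonzero product lows, with
  `R t ≤ c·qμ₁(t−s)`, and the certificate `y/(1−y)·(c(1−q)·g₀ + Σ R) ≤ c·Σ_{J<h≤M₁} gate_q μ₁ h`, `g₀` = the giant fraction of the source zero row.

[this work].  Rows served [cite: KozmaNitzan2024, Conjecture 3 (p. 15)]; [cite: Grimmett1999, §1.3 p. 10].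
-/

noncomputable section

namespace Summit.CriticalPhenomena.PercolationContinuityZ3.Theorems

namespace Quant

open Finset

namespace LawDec

/-- **H/V EXCLUSIVITY.**  If the product pair `(h, s)` receives an H-arc from the product low `(a′, s)` (`2(a′+s) < τ₁+τ₂`, source-compatible:
`τ₁ < a′ + h`) then `2s − τ₂ < 2h − τ₁`; if it receives a V-arc from `(h, s″)` (`2(h+s″) < τ₁+τ₂`, `τ₂ < s″ + s`) then `2h − τ₁ < 2s − τ₂`.
Both cannot happen. [this work] -/
theorem hv_exclusive (τ₁ τ₂ : ℝ) (a' h s'' s : ℕ) (hH1 : 2 * ((a' : ℝ) + s) < τ₁ + τ₂) (hH2 : τ₁ < (a' : ℝ) + h)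
    (hV1 : 2 * ((h : ℝ) + s'') < τ₁ + τ₂) (hV2 : τ₂ < (s'' : ℝ) + s) : False := by
  linarith

/-- **slots of a fully present H-copy take no V-arc**: `2s < τ₁+τ₂`, `τ₁ < m` (the source zero is compatible with `m`), and a V-arc from
`(m, s″)` into `(m, s)` (`2(m+s″) < τ₁+τ₂`, `τ₂ < s″ + s`) are contradictory. [this work] -/
theorem slot_exclusive (τ₁ τ₂ : ℝ) (m s'' s : ℕ) (hs : 2 * (s : ℝ) < τ₁ + τ₂) (hm : τ₁ < (m : ℝ))
    (hV1 : 2 * ((m : ℝ) + s'') < τ₁ + τ₂) (hV2 : τ₂ < (s'' : ℝ) + s) : False := by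
  linarith

/-- **THE GIANT ARCS OF A (POSSIBLY LOW) COPY.**  Shift `s` (any), weight `c ≥ 0`, source flow `f` of `gate_q μ₁` at `(y, S, J, M₁)`, product layer
`J + s`, `M₁ + s ≤ M`: the giant-bound masses `R t = c·Σ_{J<h≤M₁} f(t−s, h)` of the copy's nonzero product lows `t` (`s+1 ≤ t ≤ J+s`,
`2t < S′`), plus the share `c·qμ₁(0)·g` of the atom `t = s` when it is low, satisfy `0 ≤ R`, `R t ≤ c·qμ₁(t−s)` resp. `≤ c·qμ₁(0)`, vanish
elsewhere, and `y/(1−y)·(c·(1−q)·g₀ + Σ_t R t) ≤ c·Σ_{J<h≤M₁} gate_q μ₁ h`, where `g₀ = Σ_{J<h} f(0,h)/gate_q μ₁ 0` is the giant fraction of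
the source zero row. [this work] -/
theorem lowCopy_giants (y S S' q c : ℝ) (J s M₁ : ℕ) (μ₁ : ℕ → ℝ) (f : ℕ → ℕ → ℝ) (hy0 : 0 < y) (hy1 : y < 1) (hq0 : 0 < q) (hq1 : q ≤ 1)
    (hc0 : 0 ≤ c) (hS : 0 < S) (hμ0 : ∀ h, 0 ≤ μ₁ h) (hf : IsFlowAtT y S J M₁ (gate μ₁ q) f) :
    ∃ (R : ℕ → ℝ) (g₀ : ℝ),
      (∀ t, 0 ≤ R t) ∧ 0 ≤ g₀ ∧ g₀ ≤ 1 ∧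
      (∀ t, (s + 1 ≤ t ∧ t ≤ J + s ∧ 2 * (t : ℝ) < S') → R t ≤ c * (q * μ₁ (t - s))) ∧
      (2 * (s : ℝ) < S' → R s ≤ c * (q * μ₁ 0)) ∧
      (∀ t, ¬ (s + 1 ≤ t ∧ t ≤ J + s ∧ 2 * (t : ℝ) < S') → ¬ (t = s ∧ 2 * (s : ℝ) < S') → R t = 0) ∧
      (y / (1 - y) * (c * (1 - q) * g₀ + ∑ t ∈ Finset.range (J + s + 1), R t) ≤ c * ∑ h ∈ Finset.Ico (J + 1) (M₁ + 1), gate μ₁ q h) := by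
  classical
  have hterm := hf.term_nonneg hy0 hy1
  obtain ⟨hf0, hsupp, hrow, hcap⟩ := hf
  set ν : ℕ → ℝ := gate μ₁ q with hν
  set uy : ℝ := y / (1 - y) with huy
  have h1y : 0 < 1 - y := by linarith
  have huy0 : 0 < uy := div_pos hy0 h1y
  have hν0val : ν 0 = 1 - q + q * μ₁ 0 := by rw [hν, gate_apply, if_pos rfl]; ring
  have hν0pos : 0 < ν 0 ∨ ν 0 = 0 := by
    rcases (show 0 ≤ ν 0 by rw [hν0val]; nlinarith [hμ0 0]).eq_or_lt with h | h
    · exact Or.inr h.symm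
    · exact Or.inl h
  -- giant part of a source row
  set G : ℕ → ℝ := fun l => ∑ h ∈ Finset.Ico (J + 1) (M₁ + 1), f l h with hG
  have hG0 : ∀ l, 0 ≤ G l := fun l => Finset.sum_nonneg fun h _ => hf0 l h
  -- the giant part of a row is at most the row
  have hGle : ∀ l, l ≤ J → 2 * (l : ℝ) < S → G l ≤ ν l := by
    intro l hl h2l
    rw [← hrow l hl h2l, hG, Finset.range_eq_Ico]
    exact Finset.sum_le_sum_of_subset_of_nonneg (Finset.Ico_subset_Ico (Nat.zero_le _) le_rfl) fun h _ _ => hf0 l h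
  -- rows that are not source lows have no giant part
  have hGz : ∀ l, ¬ (l ≤ J ∧ 2 * (l : ℝ) < S) → G l = 0 := by
    intro l hl
    refine Finset.sum_eq_zero fun h _ => ?_
    by_contra hne
    have hp : 0 < f l h := lt_of_le_of_ne (hf0 l h) (Ne.symm hne)
    obtain ⟨hlJ, h2l, _, _⟩ := hsupp l h hp
    exact hl ⟨hlJ, h2l⟩
  -- the giant certificate of the source flow: `uy · Σ_l G l ≤ Σ_{giants} ν h`
  have hgiant : uy * ∑ l ∈ Finset.range (J + 1), G l ≤ ∑ h ∈ Finset.Ico (J + 1) (M₁ + 1), ν h := by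
    have hG' : ∑ l ∈ Finset.range (J + 1), G l = ∑ h ∈ Finset.Ico (J + 1) (M₁ + 1), ∑ l ∈ Finset.range (J + 1), f l h := by
      simp only [hG]; rw [Finset.sum_comm]
    rw [hG', Finset.mul_sum]
    refine Finset.sum_le_sum fun h hh => ?_
    obtain ⟨hh1, hh2⟩ := Finset.mem_Ico.1 hh
    have hc := hcap h (by omega) (Or.inl (by omega))
    have hu : ∀ l ∈ Finset.range (J + 1), usage y S J l h * f l h = uy * f l h := by
      intro l _
      rw [usage_giant_eq y S J l h (by omega)]
    rw [Finset.sum_congr rfl hu, ← Finset.mul_sum] at hc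
    exact hc
  -- the zero row's giant fraction
  set g₀ : ℝ := if 0 < ν 0 then G 0 / ν 0 else 0 with hg₀
  have hg₀0 : 0 ≤ g₀ := by
    simp only [hg₀]; split_ifs with h
    · exact div_nonneg (hG0 0) h.le
    · exact le_rfl
  have hG0le : G 0 ≤ ν 0 := hGle 0 (Nat.zero_le _) (by simpa using hS)
  have hg₀1 : g₀ ≤ 1 := by
    simp only [hg₀]; split_ifs with h
    · exact (div_le_one h).2 hG0le
    · exact zero_le_one
  have hg₀mul : g₀ * ν 0 = G 0 := by
    simp only [hg₀]; split_ifs with h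
    · exact div_mul_cancel₀ _ (ne_of_gt h)
    · rcases hν0pos with hp | hz
      · exact absurd hp h
      · rw [zero_mul]; exact le_antisymm (hG0 0) (by rw [← hz]; exact hG0le)
  -- the masses
  set R : ℕ → ℝ := fun t =>
    if (s + 1 ≤ t ∧ t ≤ J + s ∧ 2 * (t : ℝ) < S') then c * G (t - s)
    else if (t = s ∧ 2 * (s : ℝ) < S') then c * (q * μ₁ 0) * g₀ else 0 with hR
  have hR0 : ∀ t, 0 ≤ R t := fun t => by
    simp only [hR]; split_ifs
    · exact mul_nonneg hc0 (hG0 _)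
    · exact mul_nonneg (mul_nonneg hc0 (mul_nonneg hq0.le (hμ0 0))) hg₀0
    · exact le_rfl
  have hνpos : ∀ h, 1 ≤ h → ν h = q * μ₁ h := fun h hh => by rw [hν, gate_apply, if_neg (by omega)]; ring
  refine ⟨R, g₀, hR0, hg₀0, hg₀1, ?_, ?_, ?_, ?_⟩
  · intro t ht
    simp only [hR]; rw [if_pos ht]
    by_cases hl : (t - s ≤ J ∧ 2 * (((t - s : ℕ)) : ℝ) < S)
    · have := hGle (t - s) hl.1 hl.2
      rw [hνpos (t - s) (by omega)] at this
      exact mul_le_mul_of_nonneg_left this hc0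
    · rw [hGz (t - s) hl, mul_zero]; exact mul_nonneg hc0 (mul_nonneg hq0.le (hμ0 _))
  · intro hsl
    have hRs : R s = c * (q * μ₁ 0) * g₀ := by
      simp only [hR]
      rw [if_neg (by omega)]
      simp [hsl]
    rw [hRs]
    have : c * (q * μ₁ 0) * g₀ ≤ c * (q * μ₁ 0) * 1 := mul_le_mul_of_nonneg_left hg₀1 (mul_nonneg hc0 (mul_nonneg hq0.le (hμ0 0)))
    linarith
  · intro t h1 h2
    simp only [hR]; rw [if_neg h1, if_neg h2]
  · -- the certificate: `Σ_t R t ≤ c·(G-part of nonzero rows) + c·qμ₁(0)·g₀`, and `c(1−q)g₀ + c qμ₁(0) g₀ = c g₀ ν 0 = c G 0`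
    have hsumR : ∑ t ∈ Finset.range (J + s + 1), R t ≤ c * (q * μ₁ 0) * g₀ + c * ∑ l ∈ Finset.range J, G (l + 1) := by
      -- split off `t = s`, shift the rest
      have hsplit : ∑ t ∈ Finset.range (J + s + 1), R t
          = ∑ t ∈ Finset.range (J + s + 1), ((if (s + 1 ≤ t ∧ t ≤ J + s ∧ 2 * (t : ℝ) < S') then c * G (t - s) else 0)
            + (if (t = s ∧ 2 * (s : ℝ) < S') then c * (q * μ₁ 0) * g₀ else 0)) := by
        refine Finset.sum_congr rfl fun t _ => ?_
        simp only [hR]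
        by_cases h1 : (s + 1 ≤ t ∧ t ≤ J + s ∧ 2 * (t : ℝ) < S')
        · rw [if_pos h1, if_pos h1, if_neg (by omega), add_zero]
        · rw [if_neg h1, if_neg h1, zero_add]
      rw [hsplit, Finset.sum_add_distrib]
      have hB : ∑ t ∈ Finset.range (J + s + 1), (if (t = s ∧ 2 * (s : ℝ) < S') then c * (q * μ₁ 0) * g₀ else 0)
          ≤ c * (q * μ₁ 0) * g₀ := by
        have e : ∀ t ∈ Finset.range (J + s + 1), (if (t = s ∧ 2 * (s : ℝ) < S') then c * (q * μ₁ 0) * g₀ else 0)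
            = if t = s then (if 2 * (s : ℝ) < S' then c * (q * μ₁ 0) * g₀ else 0) else 0 := by
          intro t _; by_cases h : t = s
          · simp only [h, true_and, if_true]
          · rw [if_neg (fun hc => h hc.1), if_neg h]
        rw [Finset.sum_congr rfl e, Finset.sum_ite_eq' (Finset.range (J + s + 1)) s, if_pos (Finset.mem_range.2 (by omega))]
        split_ifs
        · exact le_rfl
        · exact mul_nonneg (mul_nonneg hc0 (mul_nonneg hq0.le (hμ0 0))) hg₀0
      have hA : ∑ t ∈ Finset.range (J + s + 1), (if (s + 1 ≤ t ∧ t ≤ J + s ∧ 2 * (t : ℝ) < S') then c * G (t - s) else 0)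
          ≤ c * ∑ l ∈ Finset.range J, G (l + 1) := by
        -- reindex `t = l + 1 + s`
        have hre : ∑ t ∈ Finset.range (J + s + 1), (if (s + 1 ≤ t ∧ t ≤ J + s ∧ 2 * (t : ℝ) < S') then c * G (t - s) else 0)
            ≤ ∑ t ∈ Finset.range (J + s + 1), (if (s + 1 ≤ t ∧ t ≤ J + s) then c * G (t - s) else 0) := by
          refine Finset.sum_le_sum fun t _ => ?_
          by_cases h1 : (s + 1 ≤ t ∧ t ≤ J + s ∧ 2 * (t : ℝ) < S')
          · rw [if_pos h1, if_pos ⟨h1.1, h1.2.1⟩]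
          · rw [if_neg h1]; split_ifs
            · exact mul_nonneg hc0 (hG0 _)
            · exact le_rfl
        refine le_trans hre (le_of_eq ?_)
        rw [Finset.mul_sum]
        -- both sides are `Σ_{l < J} c G(l+1)`
        rw [show J + s + 1 = (s + 1) + J by omega, Finset.sum_range_add]
        have hz : ∑ t ∈ Finset.range (s + 1), (if (s + 1 ≤ t ∧ t ≤ J + s) then c * G (t - s) else 0) = 0 :=
          Finset.sum_eq_zero fun t ht => by rw [Finset.mem_range] at ht; rw [if_neg (by omega)]
        rw [hz, zero_add]
        refine Finset.sum_congr rfl fun l hl => ?_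
        rw [Finset.mem_range] at hl
        rw [if_pos (by omega)]
        congr 2; omega
      linarith
    -- assemble
    have hGsum : ∑ l ∈ Finset.range (J + 1), G l = G 0 + ∑ l ∈ Finset.range J, G (l + 1) := by
      rw [Finset.sum_range_succ']; ring
    have hzero : c * (1 - q) * g₀ + c * (q * μ₁ 0) * g₀ = c * G 0 := by
      rw [← hg₀mul, hν0val]; ring
    calc uy * (c * (1 - q) * g₀ + ∑ t ∈ Finset.range (J + s + 1), R t)
        ≤ uy * (c * (1 - q) * g₀ + (c * (q * μ₁ 0) * g₀ + c * ∑ l ∈ Finset.range J, G (l + 1))) :=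
          mul_le_mul_of_nonneg_left (by linarith) huy0.le
      _ = c * (uy * ∑ l ∈ Finset.range (J + 1), G l) := by rw [hGsum]; linear_combination uy * hzero
      _ ≤ c * ∑ h ∈ Finset.Ico (J + 1) (M₁ + 1), ν h := mul_le_mul_of_nonneg_left hgiant hc0

end LawDec

end Quant

end Summit.CriticalPhenomena.PercolationContinuityZ3.Theorems
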